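import Mathlib
import Literature.Analysis.Complex.BorelCaratheodoryDeriv
import Literature.NumberTheory.LFunctions.RHInvZetaBound

/-!
HONEST FRAMING: exact (Metropolis-corrected) sampling algorithms for lattice gauge theory; figures
of merit are autocorrelation/cost numbers at stated couplings and volumes; no continuum-physics
claim.

# BlaschkeCoefficient — the second Taylor coefficient of `log f` against the zeros of `f` in a disc
# (Carathéodory's coefficient inequality after dividing out Blaschke factors; lean-2 GEN-7, ours)

Pure complex analysis (no lattice).  Let `f` be holomorphic on a neighbourhood of `|z| ≤ R`,
`f(0) = 1`, `|f| ≤ e^A` on `|z| = R`, and suppose the zeros of `f` in the OPEN disc have been divided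
out by Blaschke factors: `f(z)·∏_u (R² − ū z)^{m_u} = h(z)·∏_u (R(z − u))^{m_u}` on `|z| ≤ R` with
`h` holomorphic there and zero-free on `|z| < R` (`0 < |u| < R`, multiplicities `m_u`).  Since
`|R(z − u)| = |R² − ū z|` on `|z| = R`, `|h| = |f| ≤ e^A` on the circle, hence on the disc (maximum
modulus), while `|h(0)| = ∏ (R/|u|)^{m_u} ≥ 1`; the coefficient form of Borel–Carathéodory
(`Literature.Analysis.Complex.borelCaratheodory_norm_iteratedDeriv_le_of_ball`, `k = 2`) applied to
`log(h/h(0))` gives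

* **`norm_deriv_logDeriv_sub_sum_le`**:
  `‖(f′/f)′(0) − ∑_u m_u (ū²/R⁴ − 1/u²)‖ ≤ 4A/R²`, and since `|ū²/R⁴ − 1/u²| ≤ 1/|u|²`,
* **`re_deriv_logDeriv_le`**: `Re (f′/f)′(0) ≤ 4A/R² + ∑_u m_u/|u|²`.

For the complex MGF of a bounded random variable `(f′/f)′(0) = Var X` and `A = |b|R`, so the zeros
inside `|z| < R` must carry `∑ m_u/|u|² ≥ Var X − 4|b|/R`: with a zero-free radius `ρ` the NUMBER of
zeros in the disc is at least `ρ²(Var X − 4|b|/R)` — the docking (zero extraction via Mathlib's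
`divisor`, Wilson action) is left to the next file.  NOT CLAIMED here: anything lattice-specific.
-/

noncomputable section

open Complex Metric Set Filter Topology
open scoped ComplexConjugate

namespace Summit.Ventures.LatticeQCDFlow.TrivializingMaps.Blaschke

variable {R : ℝ}

/-- On the circle `|z| = R`: `|R² − ū z| = R·|z − u|`. -/
theorem norm_sq_sub_conj_mul_eq {z u : ℂ} (hz : ‖z‖ = R) :
    ‖(R : ℂ) ^ 2 - conj u * z‖ = R * ‖z - u‖ := by
  have hzz : conj z * z = (R : ℂ) ^ 2 := by
    rw [mul_comm, Complex.mul_conj, Complex.normSq_eq_norm_sq, hz]; push_cast; ring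
  have : (R : ℂ) ^ 2 - conj u * z = conj (z - u) * z := by
    rw [map_sub, sub_mul, hzz]
  rw [this, norm_mul, Complex.norm_conj, hz, mul_comm]

/-- Inside the closed disc the Blaschke denominator does not vanish: `|u| < R`, `|z| ≤ R` ⇒
`R² − ū z ≠ 0`. -/
theorem sq_sub_conj_mul_ne_zero {z u : ℂ} (hR : 0 < R) (hu : ‖u‖ < R) (hz : ‖z‖ ≤ R) :
    (R : ℂ) ^ 2 - conj u * z ≠ 0 := by
  intro h
  have h1 : ‖conj u * z‖ = R ^ 2 := by
    rw [← sub_eq_zero.mp h]; simp [Complex.norm_real, abs_of_pos hR]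
  rw [norm_mul, Complex.norm_conj] at h1
  have : ‖u‖ * ‖z‖ < R * R := by
    calc ‖u‖ * ‖z‖ ≤ ‖u‖ * R := mul_le_mul_of_nonneg_left hz (norm_nonneg _)
      _ < R * R := mul_lt_mul_of_pos_right hu hR
  nlinarith

/-- `‖ū²/R⁴ − 1/u²‖ ≤ 1/‖u‖²` for `0 < |u| < R` (it equals `(1 − |u|⁴/R⁴)/|u|²`). -/
theorem norm_coeff_le {u : ℂ} (hR : 0 < R) (hu0 : u ≠ 0) (hu : ‖u‖ < R) :
    ‖conj u ^ 2 / (R : ℂ) ^ 4 - 1 / u ^ 2‖ ≤ 1 / ‖u‖ ^ 2 := by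
  have hu2 : u ^ 2 ≠ 0 := pow_ne_zero _ hu0
  have hR4 : (R : ℂ) ^ 4 ≠ 0 := pow_ne_zero _ (by exact_mod_cast hR.ne')
  have key : conj u ^ 2 / (R : ℂ) ^ 4 - 1 / u ^ 2 =
      (1 / u ^ 2) * ((conj u * u) ^ 2 / (R : ℂ) ^ 4 - 1) := by
    field_simp
  have hcu : conj u * u = ((‖u‖ ^ 2 : ℝ) : ℂ) := by
    rw [mul_comm, Complex.mul_conj, Complex.normSq_eq_norm_sq]
  rw [key, norm_mul, hcu]
  have hin : ‖(((‖u‖ ^ 2 : ℝ) : ℂ)) ^ 2 / (R : ℂ) ^ 4 - 1‖ ≤ 1 := by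
    have hq : (((‖u‖ ^ 2 : ℝ) : ℂ)) ^ 2 / (R : ℂ) ^ 4 - 1 = (((‖u‖ ^ 4 / R ^ 4 - 1 : ℝ)) : ℂ) := by
      push_cast; ring
    rw [hq, Complex.norm_real, Real.norm_eq_abs]
    have h1 : ‖u‖ ^ 4 / R ^ 4 ≤ 1 := by
      rw [div_le_one (by positivity)]
      exact pow_le_pow_left₀ (norm_nonneg _) hu.le 4
    have h0 : 0 ≤ ‖u‖ ^ 4 / R ^ 4 := by positivity
    rw [abs_of_nonpos (by linarith)]
    linarith
  calc ‖(1 : ℂ) / u ^ 2‖ * ‖(((‖u‖ ^ 2 : ℝ) : ℂ)) ^ 2 / (R : ℂ) ^ 4 - 1‖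
      ≤ ‖(1 : ℂ) / u ^ 2‖ * 1 := mul_le_mul_of_nonneg_left hin (norm_nonneg _)
    _ = 1 / ‖u‖ ^ 2 := by rw [mul_one, norm_div, norm_one, norm_pow]

/-- `(d/dz)[1/(z − u) + ū/(R² − ū z)]` at `0` is `ū²/R⁴ − 1/u²`. -/
theorem hasDerivAt_blaschkeLogDeriv {u : ℂ} (hR : 0 < R) (hu0 : u ≠ 0) :
    HasDerivAt (fun z : ℂ => 1 / (z - u) + conj u / ((R : ℂ) ^ 2 - conj u * z))
      (conj u ^ 2 / (R : ℂ) ^ 4 - 1 / u ^ 2) 0 := by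
  have hR2 : (R : ℂ) ^ 2 ≠ 0 := pow_ne_zero _ (by exact_mod_cast hR.ne')
  have h1 : HasDerivAt (fun z : ℂ => (z - u)⁻¹) (-(1) / (0 - u) ^ 2) 0 :=
    ((hasDerivAt_id (0 : ℂ)).sub_const u).inv (by simpa using hu0)
  have h2 : HasDerivAt (fun z : ℂ => ((R : ℂ) ^ 2 - conj u * z)⁻¹)
      (-(-conj u) / ((R : ℂ) ^ 2 - conj u * 0) ^ 2) 0 := by
    have hlin : HasDerivAt (fun z : ℂ => (R : ℂ) ^ 2 - conj u * z) (-conj u) 0 := by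
      simpa using ((hasDerivAt_id (0 : ℂ)).const_mul (conj u)).const_sub ((R : ℂ) ^ 2)
    exact hlin.inv (by simpa using hR2)
  have h3 := h1.add (h2.const_mul (conj u))
  have heq : (fun z : ℂ => 1 / (z - u) + conj u / ((R : ℂ) ^ 2 - conj u * z)) =
      fun z => (z - u)⁻¹ + conj u * ((R : ℂ) ^ 2 - conj u * z)⁻¹ := by
    funext z; rw [one_div, div_eq_mul_inv]
  have hval : -(1 : ℂ) / (0 - u) ^ 2 + conj u * (-(-conj u) / ((R : ℂ) ^ 2 - conj u * 0) ^ 2) =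
      conj u ^ 2 / (R : ℂ) ^ 4 - 1 / u ^ 2 := by
    simp only [zero_sub, neg_neg, mul_zero, sub_zero, even_two, Even.neg_pow]
    ring
  rw [heq, ← hval]
  exact h3

/-- **The coefficient inequality with the zeros divided out.**  `R > 0`, `T` a finite set of points
with `0 < |u| < R` and multiplicities `m`; `f` and `h` holomorphic on `|z| ≤ R` with
`f z · ∏ (R² − ū z)^{m_u} = h z · ∏ (R (z − u))^{m_u}` there, `h` zero-free on `|z| < R`, `f 0 = 1`,
`|f| ≤ e^A` on `|z| = R`.  Then `‖(f′/f)′(0) − ∑ m_u (ū²/R⁴ − 1/u²)‖ ≤ 4A/R²`. [ours] -/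
theorem norm_deriv_logDeriv_sub_sum_le {f h : ℂ → ℂ} {A : ℝ} (hR : 0 < R) (T : Finset ℂ)
    (m : ℂ → ℕ) (hT : ∀ u ∈ T, u ≠ 0 ∧ ‖u‖ < R)
    (hf : DifferentiableOn ℂ f (closedBall 0 R)) (hh : DifferentiableOn ℂ h (closedBall 0 R))
    (hh0 : ∀ z ∈ ball (0 : ℂ) R, h z ≠ 0)
    (hfh : ∀ z ∈ closedBall (0 : ℂ) R,
      f z * ∏ u ∈ T, ((R : ℂ) ^ 2 - conj u * z) ^ m u = h z * ∏ u ∈ T, ((R : ℂ) * (z - u)) ^ m u)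
    (hf1 : f 0 = 1) (hA : ∀ z ∈ sphere (0 : ℂ) R, ‖f z‖ ≤ Real.exp A) :
    ‖deriv (logDeriv f) 0 - ∑ u ∈ T, (m u : ℂ) * (conj u ^ 2 / (R : ℂ) ^ 4 - 1 / u ^ 2)‖ ≤
      4 * A / R ^ 2 := by
  have hR0 : (R : ℂ) ≠ 0 := by exact_mod_cast hR.ne'
  -- the two polynomial factors
  set P : ℂ → ℂ := fun z => ∏ u ∈ T, ((R : ℂ) ^ 2 - conj u * z) ^ m u with hPdef
  set Q : ℂ → ℂ := fun z => ∏ u ∈ T, ((R : ℂ) * (z - u)) ^ m u with hQdef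
  have hPne : ∀ z ∈ closedBall (0 : ℂ) R, P z ≠ 0 := fun z hz => by
    simp only [hPdef]
    exact Finset.prod_ne_zero_iff.mpr fun u hu =>
      pow_ne_zero _ (sq_sub_conj_mul_ne_zero hR (hT u hu).2 (mem_closedBall_zero_iff.mp hz))
  have hQne_sphere : ∀ z ∈ sphere (0 : ℂ) R, Q z ≠ 0 := fun z hz => by
    simp only [hQdef]
    refine Finset.prod_ne_zero_iff.mpr fun u hu => pow_ne_zero _ (mul_ne_zero hR0 ?_)
    intro hzu
    have : ‖z‖ = R := by simpa using hz
    rw [sub_eq_zero.mp hzu] at this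
    exact (hT u hu).2.ne this
  have hQ0 : Q 0 ≠ 0 := by
    simp only [hQdef]
    exact Finset.prod_ne_zero_iff.mpr fun u hu =>
      pow_ne_zero _ (mul_ne_zero hR0 (by simpa using (hT u hu).1))
  -- on the sphere `‖P z‖ = ‖Q z‖`, hence `‖h z‖ = ‖f z‖ ≤ e^A`
  have hPQ_sphere : ∀ z ∈ sphere (0 : ℂ) R, ‖P z‖ = ‖Q z‖ := fun z hz => by
    have hzR : ‖z‖ = R := by simpa using hz
    simp only [hPdef, hQdef, norm_prod, norm_pow]
    refine Finset.prod_congr rfl fun u _ => ?_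
    rw [norm_sq_sub_conj_mul_eq hzR, norm_mul, Complex.norm_real, Real.norm_eq_abs,
      abs_of_pos hR]
  have hh_sphere : ∀ z ∈ sphere (0 : ℂ) R, ‖h z‖ ≤ Real.exp A := fun z hz => by
    have h1 := congrArg (‖·‖) (hfh z (sphere_subset_closedBall hz))
    simp only [norm_mul] at h1
    rw [hPQ_sphere z hz] at h1
    have hQpos : 0 < ‖Q z‖ := norm_pos_iff.mpr (hQne_sphere z hz)
    have : ‖f z‖ = ‖h z‖ := mul_right_cancel₀ hQpos.ne' h1
    rw [← this]; exact hA z hz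
  -- maximum modulus: `‖h z‖ ≤ e^A` on the closed disc
  have hh_ball : ∀ z ∈ ball (0 : ℂ) R, ‖h z‖ ≤ Real.exp A := fun z hz => by
    have hdc : DiffContOnCl ℂ h (ball (0 : ℂ) R) := by
      refine DifferentiableOn.diffContOnCl ?_
      rw [closure_ball (0 : ℂ) hR.ne']
      exact hh
    refine Complex.norm_le_of_forall_mem_frontier_norm_le isBounded_ball hdc ?_
      (subset_closure hz)
    rw [frontier_ball (0 : ℂ) hR.ne']
    exact hh_sphere
  -- `‖h 0‖ ≥ 1`
  have hh0_ge : 1 ≤ ‖h 0‖ := by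
    have h1 := congrArg (‖·‖) (hfh 0 (mem_closedBall_self hR.le))
    simp only [hf1, one_mul, norm_mul] at h1
    -- `‖P 0‖ = ∏ R^{2m}`, `‖Q 0‖ = ∏ (R‖u‖)^m ≤ ∏ (R·R)^m`
    have hP0 : ‖P 0‖ = ∏ u ∈ T, (R ^ 2) ^ m u := by
      simp only [hPdef, mul_zero, sub_zero, norm_prod, norm_pow, Complex.norm_real, Real.norm_eq_abs,
        abs_of_pos hR]
    have hQ0n : ‖Q 0‖ = ∏ u ∈ T, (R * ‖u‖) ^ m u := by
      simp only [hQdef, zero_sub, norm_prod, norm_pow, norm_mul, norm_neg, Complex.norm_real,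
        Real.norm_eq_abs, abs_of_pos hR]
    have hle : ‖Q 0‖ ≤ ‖P 0‖ := by
      rw [hP0, hQ0n]
      refine Finset.prod_le_prod (fun u _ => by positivity) fun u hu => ?_
      refine pow_le_pow_left₀ (by positivity) ?_ _
      rw [sq]
      exact mul_le_mul_of_nonneg_left (hT u hu).2.le hR.le
    have hQpos : 0 < ‖Q 0‖ := norm_pos_iff.mpr hQ0
    -- `‖P 0‖ = ‖h 0‖ ‖Q 0‖`
    by_contra hlt
    push Not at hlt
    have : ‖h 0‖ * ‖Q 0‖ < 1 * ‖Q 0‖ := mul_lt_mul_of_pos_right hlt hQpos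
    rw [one_mul, ← h1] at this
    exact absurd hle (not_le.mpr this)
  have hh0ne : h 0 ≠ 0 := fun h0 => absurd hh0_ge (by rw [h0, norm_zero]; norm_num)
  -- holomorphic logarithm of `h` on the open disc
  obtain ⟨Lh, hLd, hL0, hLder, hLexp⟩ :=
    Literature.NumberTheory.LFunctions.InvZetaRH.exists_log_of_ball (c := (0 : ℂ)) hR
      (hh.mono ball_subset_closedBall) hh0
  set L : ℂ → ℂ := fun z => Lh z - Lh 0 with hLdef
  have hLdiff : DifferentiableOn ℂ L (ball 0 R) := hLd.sub_const _
  have hL00 : L 0 = 0 := by simp [hLdef]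
  have hre : ∀ z ∈ ball (0 : ℂ) R, (L z).re ≤ A := fun z hz => by
    have e1 : (Lh z).re = Real.log ‖h z‖ := by
      rw [← hLexp z hz, Complex.norm_exp, Real.log_exp]
    have e0 : (Lh 0).re = Real.log ‖h 0‖ := by
      rw [← hLexp 0 (mem_ball_self hR), Complex.norm_exp, Real.log_exp]
    simp only [hLdef, sub_re, e1, e0]
    have hpos : 0 < ‖h z‖ := norm_pos_iff.mpr (hh0 z hz)
    have hlogz : Real.log ‖h z‖ ≤ A := by
      rw [← Real.log_exp A]; exact Real.log_le_log hpos (hh_ball z hz)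
    have hlog0 : 0 ≤ Real.log ‖h 0‖ := Real.log_nonneg hh0_ge
    linarith
  have hcoef := Literature.Analysis.Complex.borelCaratheodory_norm_iteratedDeriv_le_of_ball hR
    hLdiff hre hL00 (k := 2) (by norm_num)
  -- `L'' (0) = (logDeriv h)'(0)`
  have hLlog : iteratedDeriv 2 L 0 = deriv (logDeriv h) 0 := by
    rw [iteratedDeriv_succ, iteratedDeriv_one]
    refine Filter.EventuallyEq.deriv_eq ?_
    filter_upwards [isOpen_ball.mem_nhds (mem_ball_self hR)] with z hz
    rw [logDeriv_apply]
    exact ((hLder z hz).sub_const (Lh 0)).deriv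
  rw [hLlog] at hcoef
  -- `logDeriv f = logDeriv h + Σ m_u (1/(z-u) + ū/(R² − ū z))` near `0`
  have hfcont : ContinuousAt f 0 :=
    (hf.differentiableAt (closedBall_mem_nhds _ hR)).continuousAt
  have hf_ne : ∀ᶠ z in 𝓝 (0 : ℂ), f z ≠ 0 :=
    hfcont.eventually_ne (by rw [hf1]; exact one_ne_zero)
  have hsmall : ∀ᶠ z in 𝓝 (0 : ℂ), z ∈ ball (0 : ℂ) R ∧ (∀ u ∈ T, z - u ≠ 0) := by
    have h1 : ∀ᶠ z in 𝓝 (0 : ℂ), z ∈ ball (0 : ℂ) R := isOpen_ball.mem_nhds (mem_ball_self hR)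
    have h2 : ∀ u ∈ T, ∀ᶠ z in 𝓝 (0 : ℂ), z - u ≠ 0 := fun u hu =>
      (continuous_id.sub continuous_const).continuousAt.eventually_ne
        (by simpa using (hT u hu).1)
    have h2' : ∀ᶠ z in 𝓝 (0 : ℂ), ∀ u ∈ T, z - u ≠ 0 :=
      (T.eventually_all).mpr h2
    exact h1.and h2'
  have hident : logDeriv f =ᶠ[𝓝 (0 : ℂ)] fun z =>
      logDeriv h z + ∑ u ∈ T, (m u : ℂ) * (1 / (z - u) + conj u / ((R : ℂ) ^ 2 - conj u * z)) := by
    filter_upwards [hf_ne, hsmall, eventually_eventually_nhds.mpr hsmall] with z hfz ⟨hzb, hzu⟩ hnear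
    have hzc : z ∈ closedBall (0 : ℂ) R := ball_subset_closedBall hzb
    -- differentiability at `z`
    have hnhds : closedBall (0 : ℂ) R ∈ 𝓝 z := mem_of_superset (isOpen_ball.mem_nhds hzb)
      ball_subset_closedBall
    have hfd : DifferentiableAt ℂ f z := hf.differentiableAt hnhds
    have hhd : DifferentiableAt ℂ h z := hh.differentiableAt hnhds
    have hPfac : ∀ u ∈ T, DifferentiableAt ℂ (fun w : ℂ => ((R : ℂ) ^ 2 - conj u * w) ^ m u) z :=
      fun u _ => by fun_prop
    have hQfac : ∀ u ∈ T, DifferentiableAt ℂ (fun w : ℂ => ((R : ℂ) * (w - u)) ^ m u) z :=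
      fun u _ => by fun_prop
    have hPfac0 : ∀ u ∈ T, (fun w : ℂ => ((R : ℂ) ^ 2 - conj u * w) ^ m u) z ≠ 0 := fun u hu =>
      pow_ne_zero _ (sq_sub_conj_mul_ne_zero hR (hT u hu).2 (mem_closedBall_zero_iff.mp hzc))
    have hQfac0 : ∀ u ∈ T, (fun w : ℂ => ((R : ℂ) * (w - u)) ^ m u) z ≠ 0 := fun u hu =>
      pow_ne_zero _ (mul_ne_zero hR0 (hzu u hu))
    -- the identity `f·P = h·Q` holds near `z`, so the log-derivatives agree at `z`
    have hEq : (fun w => f w * P w) =ᶠ[𝓝 z] fun w => h w * Q w := by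
      filter_upwards [hnear] with w ⟨hwb, _⟩
      exact hfh w (ball_subset_closedBall hwb)
    have hlogEq : logDeriv (fun w => f w * P w) z = logDeriv (fun w => h w * Q w) z := by
      rw [logDeriv_apply, logDeriv_apply, hEq.deriv_eq, hEq.eq_of_nhds]
    have hPz : P z ≠ 0 := hPne z hzc
    have hQz : Q z ≠ 0 := by
      simp only [hQdef]; exact Finset.prod_ne_zero_iff.mpr hQfac0
    have hPd : DifferentiableAt ℂ P z := by simp only [hPdef]; fun_prop
    have hQd : DifferentiableAt ℂ Q z := by simp only [hQdef]; fun_prop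
    rw [logDeriv_mul z hfz hPz hfd hPd, logDeriv_mul z (hh0 z hzb) hQz hhd hQd] at hlogEq
    have hPlog : logDeriv P z = ∑ u ∈ T, (m u : ℂ) * (-conj u / ((R : ℂ) ^ 2 - conj u * z)) := by
      have := logDeriv_prod (s := T) (x := z)
        (f := fun u w => ((R : ℂ) ^ 2 - conj u * w) ^ m u) hPfac0 hPfac
      simp only [hPdef]
      rw [show (fun z => ∏ u ∈ T, ((R : ℂ) ^ 2 - conj u * z) ^ m u) =
        fun z => ∏ u ∈ T, (fun u w => ((R : ℂ) ^ 2 - conj u * w) ^ m u) u z from rfl, this]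
      refine Finset.sum_congr rfl fun u hu => ?_
      have hlin : DifferentiableAt ℂ (fun w : ℂ => (R : ℂ) ^ 2 - conj u * w) z := by fun_prop
      rw [logDeriv_fun_pow hlin, logDeriv_apply]
      congr 1
      have hd : deriv (fun w : ℂ => (R : ℂ) ^ 2 - conj u * w) z = -conj u := by
        have h' : HasDerivAt (fun w : ℂ => (R : ℂ) ^ 2 - conj u * w) (-conj u) z := by
          simpa using ((hasDerivAt_id z).const_mul (conj u)).const_sub ((R : ℂ) ^ 2)
        exact h'.deriv
      rw [hd]
    have hQlog : logDeriv Q z = ∑ u ∈ T, (m u : ℂ) * (1 / (z - u)) := by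
      have := logDeriv_prod (s := T) (x := z)
        (f := fun u w => ((R : ℂ) * (w - u)) ^ m u) hQfac0 hQfac
      simp only [hQdef]
      rw [show (fun z => ∏ u ∈ T, ((R : ℂ) * (z - u)) ^ m u) =
        fun z => ∏ u ∈ T, (fun u w => ((R : ℂ) * (w - u)) ^ m u) u z from rfl, this]
      refine Finset.sum_congr rfl fun u hu => ?_
      have hlin : DifferentiableAt ℂ (fun w : ℂ => (R : ℂ) * (w - u)) z := by fun_prop
      rw [logDeriv_fun_pow hlin, logDeriv_apply]
      congr 1
      have hd : deriv (fun w : ℂ => (R : ℂ) * (w - u)) z = R := by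
        have h' : HasDerivAt (fun w : ℂ => (R : ℂ) * (w - u)) (R : ℂ) z := by
          simpa using ((hasDerivAt_id z).sub_const u).const_mul (R : ℂ)
        exact h'.deriv
      rw [hd]
      field_simp [hzu u hu]
    rw [hPlog, hQlog] at hlogEq
    -- solve for `logDeriv f z`
    have : logDeriv f z = logDeriv h z + (∑ u ∈ T, (m u : ℂ) * (1 / (z - u))) -
        ∑ u ∈ T, (m u : ℂ) * (-conj u / ((R : ℂ) ^ 2 - conj u * z)) := by
      linear_combination hlogEq
    rw [this, add_sub_assoc, ← Finset.sum_sub_distrib]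
    congr 1
    refine Finset.sum_congr rfl fun u _ => ?_
    ring
  -- differentiate the identity at `0`
  have hsumd : ∀ u ∈ T, DifferentiableAt ℂ
      (fun z : ℂ => (m u : ℂ) * (1 / (z - u) + conj u / ((R : ℂ) ^ 2 - conj u * z))) 0 :=
    fun u hu => ((hasDerivAt_blaschkeLogDeriv hR (hT u hu).1).differentiableAt).const_mul _
  have hhlogd : DifferentiableAt ℂ (logDeriv h) 0 := by
    have hball : ball (0 : ℂ) R ∈ 𝓝 (0 : ℂ) := isOpen_ball.mem_nhds (mem_ball_self hR)
    have h1 : DifferentiableOn ℂ (deriv h) (ball 0 R) :=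
      (hh.mono ball_subset_closedBall).deriv isOpen_ball
    have h2 : DifferentiableAt ℂ (deriv h) 0 := h1.differentiableAt hball
    have h3 : DifferentiableAt ℂ h 0 := (hh.mono ball_subset_closedBall).differentiableAt hball
    have : logDeriv h = fun z => deriv h z / h z := funext fun z => logDeriv_apply h z
    rw [this]
    exact h2.div h3 hh0ne
  have hderiv : deriv (logDeriv f) 0 = deriv (logDeriv h) 0 +
      ∑ u ∈ T, (m u : ℂ) * (conj u ^ 2 / (R : ℂ) ^ 4 - 1 / u ^ 2) := by
    rw [hident.deriv_eq]
    have hsum : HasDerivAt (fun z : ℂ => ∑ u ∈ T, (m u : ℂ) *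
        (1 / (z - u) + conj u / ((R : ℂ) ^ 2 - conj u * z)))
        (∑ u ∈ T, (m u : ℂ) * (conj u ^ 2 / (R : ℂ) ^ 4 - 1 / u ^ 2)) 0 :=
      HasDerivAt.fun_sum fun u hu => (hasDerivAt_blaschkeLogDeriv hR (hT u hu).1).const_mul (m u : ℂ)
    exact (hhlogd.hasDerivAt.add hsum).deriv
  rw [hderiv, add_sub_cancel_right]
  calc ‖deriv (logDeriv h) 0‖ ≤ 2 * (Nat.factorial 2 : ℕ) * A / R ^ 2 := hcoef
    _ = 4 * A / R ^ 2 := by norm_num [Nat.factorial]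

/-- **Corollary: `Re (f′/f)′(0) ≤ 4A/R² + ∑ m_u/|u|²`** — the zeros of `f` inside the disc, weighted
by `1/|u|²`, must make up for any excess of the second logarithmic coefficient over `4A/R²`. [ours] -/
theorem re_deriv_logDeriv_le {f h : ℂ → ℂ} {A : ℝ} (hR : 0 < R) (T : Finset ℂ)
    (m : ℂ → ℕ) (hT : ∀ u ∈ T, u ≠ 0 ∧ ‖u‖ < R)
    (hf : DifferentiableOn ℂ f (closedBall 0 R)) (hh : DifferentiableOn ℂ h (closedBall 0 R))
    (hh0 : ∀ z ∈ ball (0 : ℂ) R, h z ≠ 0)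
    (hfh : ∀ z ∈ closedBall (0 : ℂ) R,
      f z * ∏ u ∈ T, ((R : ℂ) ^ 2 - conj u * z) ^ m u = h z * ∏ u ∈ T, ((R : ℂ) * (z - u)) ^ m u)
    (hf1 : f 0 = 1) (hA : ∀ z ∈ sphere (0 : ℂ) R, ‖f z‖ ≤ Real.exp A) :
    (deriv (logDeriv f) 0).re ≤ 4 * A / R ^ 2 + ∑ u ∈ T, (m u : ℝ) / ‖u‖ ^ 2 := by
  have hmain := norm_deriv_logDeriv_sub_sum_le hR T m hT hf hh hh0 hfh hf1 hA
  set D := deriv (logDeriv f) 0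
  set Sg := ∑ u ∈ T, (m u : ℂ) * (conj u ^ 2 / (R : ℂ) ^ 4 - 1 / u ^ 2) with hSg
  have h1 : D.re ≤ ‖D - Sg‖ + Sg.re := by
    have := Complex.re_le_norm (D - Sg)
    rw [Complex.sub_re] at this
    linarith
  have h2 : Sg.re ≤ ∑ u ∈ T, (m u : ℝ) / ‖u‖ ^ 2 := by
    rw [hSg, Complex.re_sum]
    refine Finset.sum_le_sum fun u hu => ?_
    calc ((m u : ℂ) * (conj u ^ 2 / (R : ℂ) ^ 4 - 1 / u ^ 2)).re
        ≤ ‖(m u : ℂ) * (conj u ^ 2 / (R : ℂ) ^ 4 - 1 / u ^ 2)‖ := Complex.re_le_norm _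
      _ = (m u : ℝ) * ‖conj u ^ 2 / (R : ℂ) ^ 4 - 1 / u ^ 2‖ := by
          rw [norm_mul, Complex.norm_natCast]
      _ ≤ (m u : ℝ) * (1 / ‖u‖ ^ 2) :=
          mul_le_mul_of_nonneg_left (norm_coeff_le hR (hT u hu).1 (hT u hu).2) (Nat.cast_nonneg _)
      _ = (m u : ℝ) / ‖u‖ ^ 2 := by ring
  linarith

end Summit.Ventures.LatticeQCDFlow.TrivializingMaps.Blaschke

end
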